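import Summits.AtomisticToContinuum.HydrodynamicLimit.Theorems.RelayRaceLocalityLightConeInLawCSRLine
import Summits.AtomisticToContinuum.HydrodynamicLimit.Theorems.RelayRaceLocalityLightConeInLawStubProfileId
import Literature.Analysis.FunctionSpaces.TorusHardCoreCutoff

/-!
# Crux `LightConeInLaw` (stmt-AtomisticToContinuum-12500), line `count-sufficiency-reduction` —
# stub `stub_countCentre` (ball-count law of large numbers with a common centre)

Registered statics stub 1a of the lead's skeleton `Cruxes/LightConeInLaw/Lines/count_sufficiency_reduction.lean`
(route `RelayRaceLocality`), proved with the registered signature verbatim (`stub_countCentre`, end of file).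

For the two canonical local-Gibbs gases of the crux at time `0` — gas 1 with `N + 1` spheres,
gas 2 with `n₂ N` spheres of the same diameter `ε_N = hsDiameter σ₁ N`, `n₂ N ε_N³ → σ₂³` — whose
density laws of large numbers (`LLNAt … 0`) hold towards continuous `ρ₁, ρ₂` with
`ρ₁ σ₁³ = ρ₂ σ₂³` on `B(x₀, R)`, and a ball `B' = B(x₀, R')`, `0 < R' < R`: both ball counts,
normalised by `N + 1`, converge in probability to `m = ∫_{B'} ρ₁` (`CountLLN`).

Proof (elementary measure theory on `𝕋³`, no literature):
* `CountCentre.countLLN_of_densityLLN` — for a general family with `n N / (N + 1) → c` and a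
  flow-free density LLN towards a continuous `ρ`, `ballCount/(N+1) → c ∫_{B'} ρ` in probability:
  sandwich `𝟙_{B'}` between the continuous piecewise-linear cut-offs
  `θ((R' - dist(·, x₀))(k+1) + 1) ≤ 𝟙_{B'} ≤ θ((R' - dist(·, x₀))(k+1) + 2)` (`θ = Torus.cutProfile`
  of `FunctionSpaces/TorusHardCoreCutoff`, `Torus.continuous_euclidDist`), apply the density LLN to
  both, and let `k → ∞`: `∫ (cut-off) ρ → ∫_{B'} ρ` by dominated convergence, because the sphere
  `{dist(·, x₀) = R'}` is Haar-null (`Torus.volume_euclidDist_eq`);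
* the flow `Φ_0` is removed from `LLNAt` by `ProfileId.particleLaw_preimage_flow_zero`;
* gas 1: `c = 1`; gas 2: `c = σ₂³/σ₁³` (`succ_mul_hsDiameter_pow_three`) and
  `(σ₂³/σ₁³) ∫_{B'} ρ₂ = ∫_{B'} ρ₁` by the agreement on `B(x₀, R) ⊇ B'`.
-/

namespace Summit.AtomisticToContinuum.HydrodynamicLimit.Theorems.LightConeInLawCSR

open scoped BigOperators Topology Classical ENNReal ProbabilityTheory
open Filter Set MeasureTheory ProbabilityTheory
open Literature.MathematicalPhysics.KineticTheory Literature.Analysis.FluidPDE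
open Literature.Analysis.FunctionSpaces.Torus (cutProfile isCutProfile_cutProfile)
open Summit.AtomisticToContinuum.HydrodynamicLimit.Theorems.LightConeInLawSketch

noncomputable section

namespace CountCentre

/-! ## Deterministic sandwich of the ball count -/

/-- The sum of a test function over the positions is the particle number times the empirical
density field (also for zero particles, when both sides vanish). -/
theorem sum_eq_card_mul_empiricalDensityField {n : ℕ} (z : Config n (Fin 3) T3) (χ : T3 → ℝ) :
    ∑ i, χ (z i).1 = (n : ℝ) * empiricalDensityField z χ := by
  rw [empiricalDensityField_eq_sum]
  rcases Nat.eq_zero_or_pos n with hn | hn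
  · subst hn
    simp
  · rw [← mul_assoc, mul_inv_cancel₀ (Nat.cast_pos.2 hn).ne', one_mul]

/-- Upper sandwich: a nonnegative test function which is `≥ 1` on the open ball dominates the
ball count. -/
theorem ballCount_le_sum {n : ℕ} (x₀ : T3) (R' : ℝ) {χ : T3 → ℝ}
    (h1 : ∀ x, Torus.euclidDist x x₀ < R' → 1 ≤ χ x) (h0 : ∀ x, 0 ≤ χ x)
    (z : Config n (Fin 3) T3) : (ballCount x₀ R' z : ℝ) ≤ ∑ i, χ (z i).1 := by
  rw [ballCount_cast_eq_sum]
  refine Finset.sum_le_sum fun i _ => ?_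
  split_ifs with h
  · exact h1 _ h
  · exact h0 _

/-- Lower sandwich: a test function which is `≤ 1` everywhere and `≤ 0` off the open ball is
dominated by the ball count. -/
theorem sum_le_ballCount {n : ℕ} (x₀ : T3) (R' : ℝ) {χ : T3 → ℝ} (h1 : ∀ x, χ x ≤ 1)
    (h0 : ∀ x, ¬ Torus.euclidDist x x₀ < R' → χ x ≤ 0) (z : Config n (Fin 3) T3) :
    ∑ i, χ (z i).1 ≤ (ballCount x₀ R' z : ℝ) := by
  rw [ballCount_cast_eq_sum]
  refine Finset.sum_le_sum fun i _ => ?_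
  split_ifs with h
  · exact h1 _
  · exact h0 _ h

/-- The real-arithmetic core of the sandwich: if `r e₂ ≤ b ≤ r e₁` with `eᵢ` within `η` of `Aᵢ`,
`r` within `η'` of `c` (and `r ≤ |c| + 1`), `|c| |Aᵢ - m| ≤ δ/3`, and the error budget
`(|c| + 1) η ≤ δ/3`, `(|A₁| + |A₂| + 1) η' ≤ δ/3`, then `|b - c m| ≤ δ`. -/
theorem abs_sub_le_of_sandwich {b r c m e₁ e₂ A₁ A₂ η η' δ : ℝ} (hr : 0 ≤ r)
    (hrc : |r - c| ≤ η') (hr1 : r ≤ |c| + 1) (hb₁ : b ≤ r * e₁) (hb₂ : r * e₂ ≤ b)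
    (h₁ : |e₁ - A₁| ≤ η) (h₂ : |e₂ - A₂| ≤ η) (hA₁ : |c| * |A₁ - m| ≤ δ / 3)
    (hA₂ : |c| * |A₂ - m| ≤ δ / 3) (hη : (|c| + 1) * η ≤ δ / 3)
    (hη' : (|A₁| + |A₂| + 1) * η' ≤ δ / 3) : |b - c * m| ≤ δ := by
  have hη0 : 0 ≤ η := (abs_nonneg _).trans h₁
  have hη'0 : 0 ≤ η' := (abs_nonneg _).trans hrc
  have u1 : r * (e₁ - A₁) ≤ r * η := mul_le_mul_of_nonneg_left (abs_le.1 h₁).2 hr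
  have u2 : (r - c) * A₁ ≤ η' * |A₁| :=
    (le_abs_self _).trans (by rw [abs_mul]; exact mul_le_mul_of_nonneg_right hrc (abs_nonneg _))
  have u3 : c * (A₁ - m) ≤ δ / 3 := (le_abs_self _).trans (by rw [abs_mul]; exact hA₁)
  have l1 : r * (A₂ - e₂) ≤ r * η :=
    mul_le_mul_of_nonneg_left (by linarith [(abs_le.1 h₂).1]) hr
  have l2 : (c - r) * A₂ ≤ η' * |A₂| :=
    (le_abs_self _).trans
      (by rw [abs_mul, abs_sub_comm]; exact mul_le_mul_of_nonneg_right hrc (abs_nonneg _))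
  have l3 : c * (m - A₂) ≤ δ / 3 :=
    (le_abs_self _).trans (by rw [abs_mul, abs_sub_comm]; exact hA₂)
  have u4 : r * η ≤ (|c| + 1) * η := mul_le_mul_of_nonneg_right hr1 hη0
  have u5 : η' * |A₁| ≤ (|A₁| + |A₂| + 1) * η' := by nlinarith [mul_nonneg hη'0 (abs_nonneg A₂)]
  have l5 : η' * |A₂| ≤ (|A₁| + |A₂| + 1) * η' := by nlinarith [mul_nonneg hη'0 (abs_nonneg A₁)]
  have iu : r * e₁ - c * m = r * (e₁ - A₁) + (r - c) * A₁ + c * (A₁ - m) := by ring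
  have il : c * m - r * e₂ = r * (A₂ - e₂) + (c - r) * A₂ + c * (m - A₂) := by ring
  rw [abs_le]
  constructor
  · linarith
  · linarith

/-! ## The collar limit `∫ θ((R' - dist)(k+1) + b) ρ → ∫_{B'} ρ` -/

/-- The cut-offs `x ↦ θ((R' - dist(x, x₀)) a + b)` are continuous on `𝕋³`. -/
theorem continuous_cut (x₀ : T3) (R' a b : ℝ) :
    Continuous fun x : T3 => cutProfile ((R' - Torus.euclidDist x x₀) * a + b) :=
  isCutProfile_cutProfile.continuous.comp
    (((continuous_const.sub (Torus.continuous_euclidDist.comp₂ continuous_id continuous_const)).mul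
      continuous_const).add continuous_const)

/-- **Collar limit.** For continuous `ρ`, `R' ≠ 0` and any offset `b`,
`∫ θ((R' - dist(x, x₀))(k+1) + b) ρ(x) dx → ∫_{B(x₀,R')} ρ` as `k → ∞`: dominated convergence, the
cut-offs converging to the indicator of the open ball off the Haar-null sphere
`{dist(·, x₀) = R'}` (`Torus.volume_euclidDist_eq`). -/
theorem tendsto_integral_cut {ρ : T3 → ℝ} (hρ : Continuous ρ) (x₀ : T3) {R' : ℝ} (hR' : R' ≠ 0)
    (b : ℝ) :
    Tendsto (fun k : ℕ => ∫ x, cutProfile ((R' - Torus.euclidDist x x₀) * ((k : ℝ) + 1) + b) * ρ x)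
      atTop (𝓝 (∫ x in {x | Torus.euclidDist x x₀ < R'}, ρ x)) := by
  have hd : Continuous fun x : T3 => Torus.euclidDist x x₀ :=
    Torus.continuous_euclidDist.comp₂ continuous_id continuous_const
  rw [← integral_indicator (isOpen_lt hd continuous_const).measurableSet]
  refine tendsto_integral_of_dominated_convergence (fun x => |ρ x|)
    (fun k => ((continuous_cut x₀ R' _ b).mul hρ).aestronglyMeasurable)
    (integrable_of_continuous_T3 hρ).abs (fun k => ae_of_all _ fun x => ?_) ?_
  · rw [Real.norm_eq_abs, abs_mul]
    exact mul_le_of_le_one_left (abs_nonneg _) (abs_le.2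
      ⟨by linarith [isCutProfile_cutProfile.nonneg ((R' - Torus.euclidDist x x₀) * ((k : ℝ) + 1) + b)],
        isCutProfile_cutProfile.le_one _⟩)
  · have hae : ∀ᵐ x ∂(volume : Measure T3), Torus.euclidDist x x₀ ≠ R' := by
      rw [ae_iff]
      simpa only [ne_eq, not_not] using Torus.volume_euclidDist_eq hR' x₀
    refine hae.mono fun x hx => ?_
    have hT : Tendsto (fun k : ℕ => |R' - Torus.euclidDist x x₀| * ((k : ℝ) + 1)) atTop atTop :=
      (tendsto_atTop_add_const_right _ 1 tendsto_natCast_atTop_atTop).const_mul_atTop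
        (abs_pos.2 (sub_ne_zero.2 (Ne.symm hx)))
    rcases lt_or_gt_of_ne hx with h | h
    · rw [indicator_of_mem (by exact h)]
      refine tendsto_nhds_of_eventually_eq ((hT.eventually_ge_atTop (2 - b)).mono fun k hk => ?_)
      show cutProfile ((R' - Torus.euclidDist x x₀) * ((k : ℝ) + 1) + b) * ρ x = ρ x
      rw [abs_of_pos (sub_pos.2 h)] at hk
      rw [isCutProfile_cutProfile.of_two_le _ (by linarith), one_mul]
    · rw [indicator_of_notMem (by simpa only [mem_setOf_eq, not_lt] using h.le)]
      refine tendsto_nhds_of_eventually_eq ((hT.eventually_ge_atTop (b - 1)).mono fun k hk => ?_)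
      show cutProfile ((R' - Torus.euclidDist x x₀) * ((k : ℝ) + 1) + b) * ρ x = 0
      rw [abs_of_neg (sub_neg.2 h)] at hk
      rw [isCutProfile_cutProfile.of_le_one _ (by linarith), zero_mul]

/-! ## The count LLN from a density LLN -/

/-- **One step of the sandwich.** Given continuous cut-offs `χl ≤ 𝟙_{B'} ≤ χu` whose `ρ`-integrals
are `δ/(3|c|)`-close to `m`, a flow-free density LLN towards `ρ` and `n N/(N+1) → c`, the
probability that `ballCount/(N+1)` deviates from `c m` by more than `δ` tends to `0`. -/
theorem tendsto_count_of_cutoffs {n : ℕ → ℕ} (P : (N : ℕ) → Measure (Config (n N) (Fin 3) T3))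
    {ρ : T3 → ℝ}
    (hD : ∀ χ : T3 → ℝ, Continuous χ → ∀ δ : ℝ, 0 < δ →
      Tendsto (fun N => P N {z | δ < |empiricalDensityField z χ - ∫ x, χ x * ρ x|}) atTop (𝓝 0))
    {c : ℝ} (hc : Tendsto (fun N => (n N : ℝ) / ((N : ℝ) + 1)) atTop (𝓝 c)) (x₀ : T3) (R' : ℝ)
    {m δ : ℝ} (hδ : 0 < δ) {χu χl : T3 → ℝ} (hχu : Continuous χu) (hχl : Continuous χl)
    (hχu1 : ∀ x, Torus.euclidDist x x₀ < R' → 1 ≤ χu x) (hχu0 : ∀ x, 0 ≤ χu x)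
    (hχl1 : ∀ x, χl x ≤ 1) (hχl0 : ∀ x, ¬ Torus.euclidDist x x₀ < R' → χl x ≤ 0)
    (hAu : |c| * |(∫ x, χu x * ρ x) - m| ≤ δ / 3) (hAl : |c| * |(∫ x, χl x * ρ x) - m| ≤ δ / 3) :
    Tendsto (fun N => P N {z | δ < |(ballCount x₀ R' z : ℝ) / ((N : ℝ) + 1) - c * m|}) atTop
      (𝓝 0) := by
  -- the error budget
  set Au : ℝ := ∫ x, χu x * ρ x with hAudef
  set Al : ℝ := ∫ x, χl x * ρ x with hAldef
  have hc1 : (0 : ℝ) < |c| + 1 := by positivity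
  have hAA : (0 : ℝ) < |Au| + |Al| + 1 := by positivity
  set η : ℝ := δ / (3 * (|c| + 1)) with hηdef
  set η' : ℝ := δ / (3 * (|Au| + |Al| + 1)) with hη'def
  have hη0 : 0 < η := by positivity
  have hη'0 : 0 < η' := by positivity
  have hη : (|c| + 1) * η = δ / 3 := by rw [hηdef]; field_simp
  have hη' : (|Au| + |Al| + 1) * η' = δ / 3 := by rw [hη'def]; field_simp
  -- `n N / (N + 1)` is eventually close to `c`
  have hr : ∀ᶠ N in atTop, |(n N : ℝ) / ((N : ℝ) + 1) - c| < η' ∧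
      |(n N : ℝ) / ((N : ℝ) + 1) - c| < 1 := by
    have h1 := Metric.tendsto_nhds.1 hc η' hη'0
    have h2 := Metric.tendsto_nhds.1 hc 1 one_pos
    filter_upwards [h1, h2] with N a b
    rw [Real.dist_eq] at a b
    exact ⟨a, b⟩
  -- the bad event is covered by the two LLN bad events
  have hsub : ∀ᶠ N in atTop,
      {z : Config (n N) (Fin 3) T3 | δ < |(ballCount x₀ R' z : ℝ) / ((N : ℝ) + 1) - c * m|} ⊆
        {z | η < |empiricalDensityField z χu - Au|} ∪
          {z | η < |empiricalDensityField z χl - Al|} := by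
    filter_upwards [hr] with N hN z hz
    simp only [mem_setOf_eq, mem_union] at hz ⊢
    by_contra hcon
    simp only [not_or, not_lt] at hcon
    have hN0 : (0 : ℝ) < (N : ℝ) + 1 := by positivity
    have hb₁ : (ballCount x₀ R' z : ℝ) / ((N : ℝ) + 1) ≤
        (n N : ℝ) / ((N : ℝ) + 1) * empiricalDensityField z χu := by
      rw [← mul_div_right_comm, ← sum_eq_card_mul_empiricalDensityField]
      exact div_le_div_of_nonneg_right (ballCount_le_sum x₀ R' hχu1 hχu0 z) hN0.le
    have hb₂ : (n N : ℝ) / ((N : ℝ) + 1) * empiricalDensityField z χl ≤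
        (ballCount x₀ R' z : ℝ) / ((N : ℝ) + 1) := by
      rw [← mul_div_right_comm, ← sum_eq_card_mul_empiricalDensityField]
      exact div_le_div_of_nonneg_right (sum_le_ballCount x₀ R' hχl1 hχl0 z) hN0.le
    have hr1 : (n N : ℝ) / ((N : ℝ) + 1) ≤ |c| + 1 := by
      linarith [(abs_sub_lt_iff.1 hN.2).1, le_abs_self c]
    have key := abs_sub_le_of_sandwich (div_nonneg (Nat.cast_nonneg _) hN0.le) hN.1.le hr1
      hb₁ hb₂ hcon.1 hcon.2 hAu hAl hη.le hη'.le
    linarith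
  -- squeeze
  have hlim := (hD χu hχu η hη0).add (hD χl hχl η hη0)
  rw [add_zero] at hlim
  exact tendsto_of_tendsto_of_tendsto_of_le_of_le' tendsto_const_nhds hlim
    (Eventually.of_forall fun _ => zero_le)
    (hsub.mono fun N h => (measure_mono h).trans (measure_union_le _ _))

/-- **Count LLN from a density LLN.** For a general family (`n N` particles, laws `P N`) with a
flow-free density law of large numbers towards a continuous `ρ` and `n N / (N + 1) → c`, the ball
count normalised by `N + 1` converges in probability to `c ∫_{B(x₀,R')} ρ` (`0 < R'`). -/
theorem countLLN_of_densityLLN {n : ℕ → ℕ} (P : (N : ℕ) → Measure (Config (n N) (Fin 3) T3))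
    {ρ : T3 → ℝ} (hρ : Continuous ρ)
    (hD : ∀ χ : T3 → ℝ, Continuous χ → ∀ δ : ℝ, 0 < δ →
      Tendsto (fun N => P N {z | δ < |empiricalDensityField z χ - ∫ x, χ x * ρ x|}) atTop (𝓝 0))
    {c : ℝ} (hc : Tendsto (fun N => (n N : ℝ) / ((N : ℝ) + 1)) atTop (𝓝 c)) (x₀ : T3) {R' : ℝ}
    (hR' : 0 < R') :
    CountLLN n P x₀ R' (c * ∫ x in {x | Torus.euclidDist x x₀ < R'}, ρ x) := by
  intro δ hδ
  -- the collar `k`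
  have hc1 : (0 : ℝ) < |c| + 1 := by positivity
  set e : ℝ := δ / (3 * (|c| + 1)) with hedef
  have he0 : 0 < e := by positivity
  have he : (|c| + 1) * e = δ / 3 := by rw [hedef]; field_simp
  obtain ⟨k, hku, hkl⟩ :=
    ((Metric.tendsto_nhds.1 (tendsto_integral_cut hρ x₀ hR'.ne' 2) e he0).and
      (Metric.tendsto_nhds.1 (tendsto_integral_cut hρ x₀ hR'.ne' 1) e he0)).exists
  rw [Real.dist_eq] at hku hkl
  have hk : (0 : ℝ) ≤ (k : ℝ) + 1 := by positivity
  have hclose : ∀ {A : ℝ}, |A - ∫ x in {x | Torus.euclidDist x x₀ < R'}, ρ x| < e →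
      |c| * |A - ∫ x in {x | Torus.euclidDist x x₀ < R'}, ρ x| ≤ δ / 3 := fun h => by
    calc _ ≤ |c| * e := mul_le_mul_of_nonneg_left h.le (abs_nonneg c)
      _ ≤ (|c| + 1) * e := by nlinarith
      _ = δ / 3 := he
  exact tendsto_count_of_cutoffs P hD hc x₀ R' hδ
    (χu := fun x => cutProfile ((R' - Torus.euclidDist x x₀) * ((k : ℝ) + 1) + 2))
    (χl := fun x => cutProfile ((R' - Torus.euclidDist x x₀) * ((k : ℝ) + 1) + 1))
    (continuous_cut x₀ R' _ 2) (continuous_cut x₀ R' _ 1)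
    (fun x hx => (isCutProfile_cutProfile.of_two_le _
      (by linarith [mul_nonneg (sub_nonneg.2 hx.le) hk])).ge)
    (fun x => isCutProfile_cutProfile.nonneg _) (fun x => isCutProfile_cutProfile.le_one _)
    (fun x hx => (isCutProfile_cutProfile.of_le_one _
      (by linarith [mul_nonpos_of_nonpos_of_nonneg (sub_nonpos.2 (not_lt.1 hx)) hk])).le)
    (hclose hku) (hclose hkl)

end CountCentre

open CountCentre

/-- **STUB 1a — COUNT CENTRE** (registered stub `stub_countCentre` of the line
`count-sufficiency-reduction`, crux `LightConeInLaw`). For the two gases of the crux at time `0`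
(laws of large numbers `LLNAt … 0` towards continuous data `ρ₁, ρ₂` whose REDUCED densities agree on
`B(x₀, R)`) and a ball `B' = B(x₀, R')`, `0 < R' < R`: the ball counts of BOTH gases, normalised by
`N + 1`, converge in probability to the SAME number `m := ∫_{B'} ρ₁`. Gas 1 is
`countLLN_of_densityLLN` with `c = 1`; gas 2 with `c = σ₂³/σ₁³` (`n₂ N/(N+1) → (σ₂/σ₁)³` from
`n₂ N ε_N³ → σ₂³` and `(N+1) ε_N³ = σ₁³`), which compensates `ρ₂ = ρ₁ σ₁³/σ₂³` on the ball. -/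
theorem stub_countCentre :
    ∀ (a₁ θ₁ a₂ θ₂ : T3 → ℝ) (u₁ u₂ : T3 → V3),
    ∀ (σ₁ σ₂ : ℝ), 0 < σ₁ → 0 < σ₂ →
    ∀ n₂ : ℕ → ℕ, Tendsto (fun N => (n₂ N : ℝ) * hsDiameter σ₁ N ^ 3) atTop (𝓝 (σ₂ ^ 3)) →
    ∀ (Φ₁ : (N : ℕ) → HardSphereFlow G3 (hsDiameter σ₁ N) (N + 1))
      (Φ₂ : (N : ℕ) → HardSphereFlow G3 (hsDiameter σ₁ N) (n₂ N)),
    (∀ N, IsProbabilityMeasure (localGibbsLaw σ₁ a₁ u₁ θ₁ N (Φ₁ N))) →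
    (∀ N, IsProbabilityMeasure (particleLaw (Φ₂ N)
      (canonicalDensity G3 (hsDiameter σ₁ N) (n₂ N) (localGibbsProfile a₂ u₂ θ₂)))) →
    ∀ (ρ₁ Θ₁ ρ₂ Θ₂ : T3 → ℝ) (U₁ U₂ : T3 → V3), Continuous ρ₁ → Continuous ρ₂ →
    LLNAt (fun N => N + 1) (fun N => localGibbsLaw σ₁ a₁ u₁ θ₁ N (Φ₁ N)) Φ₁ ρ₁ U₁ Θ₁ 0 →
    LLNAt n₂ (fun N => particleLaw (Φ₂ N)
      (canonicalDensity G3 (hsDiameter σ₁ N) (n₂ N) (localGibbsProfile a₂ u₂ θ₂))) Φ₂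
      ρ₂ U₂ Θ₂ 0 →
    ∀ (x₀ : T3) (R R' : ℝ), 0 < R' → R' < R →
      (∀ x, Torus.euclidDist x x₀ < R → ρ₁ x * σ₁ ^ 3 = ρ₂ x * σ₂ ^ 3) →
      CountLLN (fun N => N + 1) (fun N => localGibbsLaw σ₁ a₁ u₁ θ₁ N (Φ₁ N)) x₀ R'
        (∫ x in {x | Torus.euclidDist x x₀ < R'}, ρ₁ x) ∧
      CountLLN n₂ (fun N => particleLaw (Φ₂ N)
        (canonicalDensity G3 (hsDiameter σ₁ N) (n₂ N) (localGibbsProfile a₂ u₂ θ₂))) x₀ R'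
        (∫ x in {x | Torus.euclidDist x x₀ < R'}, ρ₁ x) := by
  intro a₁ θ₁ a₂ θ₂ u₁ u₂ σ₁ σ₂ hσ₁ _ n₂ hn₂ Φ₁ Φ₂ _ _ ρ₁ Θ₁ ρ₂ Θ₂ U₁ U₂ hρ₁ hρ₂ hL₁ hL₂
    x₀ R R' hR' hR'R hagree
  -- flow-free density laws of large numbers
  have hD₁ : ∀ χ : T3 → ℝ, Continuous χ → ∀ δ : ℝ, 0 < δ →
      Tendsto (fun N => localGibbsLaw σ₁ a₁ u₁ θ₁ N (Φ₁ N)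
        {z | δ < |empiricalDensityField z χ - ∫ x, χ x * ρ₁ x|}) atTop (𝓝 0) := by
    intro χ hχ δ hδ
    refine ((hL₁ χ hχ δ hδ).1).congr fun N => ?_
    exact ProfileId.particleLaw_preimage_flow_zero (Φ₁ N) _
      {w | δ < |empiricalDensityField w χ - ∫ x, χ x * ρ₁ x|}
  have hD₂ : ∀ χ : T3 → ℝ, Continuous χ → ∀ δ : ℝ, 0 < δ →
      Tendsto (fun N => particleLaw (Φ₂ N)
        (canonicalDensity G3 (hsDiameter σ₁ N) (n₂ N) (localGibbsProfile a₂ u₂ θ₂))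
        {z | δ < |empiricalDensityField z χ - ∫ x, χ x * ρ₂ x|}) atTop (𝓝 0) := by
    intro χ hχ δ hδ
    refine ((hL₂ χ hχ δ hδ).1).congr fun N => ?_
    exact ProfileId.particleLaw_preimage_flow_zero (Φ₂ N) _
      {w | δ < |empiricalDensityField w χ - ∫ x, χ x * ρ₂ x|}
  -- the normalisation ratios
  have hr₁ : Tendsto (fun N : ℕ => ((N + 1 : ℕ) : ℝ) / ((N : ℝ) + 1)) atTop (𝓝 1) :=
    tendsto_const_nhds.congr fun N => by
      rw [Nat.cast_succ, div_self (by positivity : ((N : ℝ) + 1) ≠ 0)]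
  have hr₂ : Tendsto (fun N => (n₂ N : ℝ) / ((N : ℝ) + 1)) atTop (𝓝 (σ₂ ^ 3 / σ₁ ^ 3)) := by
    refine (hn₂.div_const (σ₁ ^ 3)).congr fun N => ?_
    have h := succ_mul_hsDiameter_pow_three σ₁ N
    rw [Nat.cast_succ] at h
    have hN : (0 : ℝ) < (N : ℝ) + 1 := by positivity
    rw [div_eq_div_iff (pow_pos hσ₁ 3).ne' hN.ne', ← h]
    ring
  -- gas 1
  have h1 := countLLN_of_densityLLN (n := fun N => N + 1)
    (fun N => localGibbsLaw σ₁ a₁ u₁ θ₁ N (Φ₁ N)) hρ₁ hD₁ hr₁ x₀ hR'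
  rw [one_mul] at h1
  -- gas 2
  have h2 := countLLN_of_densityLLN (n := n₂) (fun N => particleLaw (Φ₂ N)
    (canonicalDensity G3 (hsDiameter σ₁ N) (n₂ N) (localGibbsProfile a₂ u₂ θ₂))) hρ₂ hD₂ hr₂ x₀ hR'
  have hm : σ₂ ^ 3 / σ₁ ^ 3 * ∫ x in {x | Torus.euclidDist x x₀ < R'}, ρ₂ x =
      ∫ x in {x | Torus.euclidDist x x₀ < R'}, ρ₁ x := by
    rw [← integral_const_mul]
    refine setIntegral_congr_fun (isOpen_lt (Torus.continuous_euclidDist.comp₂ continuous_id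
      continuous_const) continuous_const).measurableSet fun x hx => ?_
    have ha := hagree x (lt_trans hx hR'R)
    rw [div_mul_eq_mul_div, div_eq_iff (pow_pos hσ₁ 3).ne', ha]
    ring
  rw [hm] at h2
  exact ⟨h1, h2⟩

end

end Summit.AtomisticToContinuum.HydrodynamicLimit.Theorems.LightConeInLawCSR
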